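import Summits.CriticalPhenomena.PercolationContinuityZ3.Theorems.PercLowPointHalfSpaceQuantitativeBGNWallChain
import Summits.CriticalPhenomena.PercolationContinuityZ3.Theorems.PercLowPointHalfSpaceQuantitativeBGNThinFootSlabVolume
import Summits.CriticalPhenomena.PercolationContinuityZ3.Theorems.PercLowPointHalfSpaceQuantitativeBGNArmVolume
import Mathlib.Analysis.SpecialFunctions.Pow.Real
import HarnessLib

/-!
# `QuantitativeBGN` (stmt-CriticalPhenomena-0913), line `longrange-wall-ghost-bootstrap` — the thin part, reshaped (lead c5)

Crux `Summit.CriticalPhenomena.PercolationContinuityZ3.Theses.PercLowPointHalfSpace.QuantitativeBGN`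
(`∃ a C, 0 < a ∧ ∀ r ≥ 1, P_{p_c(ℤ³)}(arm_H(0,r)) ≤ C r^{-a}`), line `longrange-wall-ghost-bootstrap`
(skeleton `Cruxes/QuantitativeBGN/Lines/longrange_wall_ghost_bootstrap.lean`). Lead c4 landed the exact split
`QuantitativeBGN ⟺ FootprintTail ∧ ThinFootTall` (`…WallChain.lean`). This file reshapes the THIN part
`ThinFootTall` (K3: `∃ a, δ > 0, C, P_{p_c}(arm_H(0,r), F ≤ ⌊r^δ⌋) ≤ C r^{-a}`, `F = |C_H(0) ∩ ∂H|`) into the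
cleaner, equivalent statement `ThinFootHigh` (K3': `∃ a, δ > 0, C, P_{p_c}(∃ v ∈ C_H(0), v₀ ≥ k, and F ≤ ⌊k^δ⌋) ≤ C k^{-a}`
— "without loss of generality the thin-footed arm goes straight up"), using the two landed `p`-blind stubs

* `stub_thinFootSlabVolume` (p137452): `P_p(|C_H(0) ∩ {x₀ < k}| ≥ t, F ≤ m) ≤ m k / t` for every `p` — the ℤ²-level
  mass transport `E_p[N_h(U) 1{F ≤ m}/F] ≤ 1` summed over the levels `h < k`, then Markov;
* `stub_armVolume` (p137693): on lattice configurations, `arm_H(0,r) ⟹ |C_H(0)| ≥ r + 1`.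

Contents (all statements spelled out over `armH`, `clusterH`, `footAt`, `footGe`; no new definitions):
* `thinFootTall_of_thinFootHigh` — K3 ⟸ K3': with `k = ⌊r^{1/3}⌋ + 1`, `m = ⌊r^{δ'}⌋`, `δ' = min(δ/3, 1/6)`, a
  thin-footed arm a.s. either has a vertex at height `≥ k` (K3': `≤ C k^{-a} ≤ C⁺ r^{-a/3}`) or lies in the slab
  `{x₀ < k}` with `≥ r + 1` vertices (`≤ m k/(r+1) ≤ 2 r^{-1/2}`); output exponent `min(a/3, 1/2)`, thinness `δ'`;
* `thinFootHigh_of_thinFootTall` — K3 ⟹ K3' (`{∃ v ∈ C_H(0), v₀ ≥ k} ⊆ arm_H(0,k)`);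
* `thinFootTall_iff_thinFootHigh`, `thinFootHigh_of_quantitativeBGN`;
* `quantitativeBGN_of_wallStable_of_thinFootHigh` — the line in its c5 form: K2_T + K3' ⟹ the crux BY NAME;
* `quantitativeBGN_iff_footprintTail_and_thinFootHigh` — the crux splits exactly into `FootprintTail ∧ ThinFootHigh`.
-/

noncomputable section

namespace Summit.CriticalPhenomena.PercolationContinuityZ3.Theorems

open MeasureTheory Literature.Probability.Percolation Literature.Probability.LatticeModels
open Summit.CriticalPhenomena.PercolationContinuityZ3.Theorems.WallGhost
open Summit.CriticalPhenomena.PercolationContinuityZ3.Theorems.QuantitativeBGN.Negative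
  (armH QuantitativeBGNAt quantitativeBGN_iff)
open scoped ENNReal

namespace ThinFootReshape

/-- Arithmetic of the scales: for `r ≥ 1`, `k = ⌊r^{1/3}⌋ + 1` satisfies `r^{1/3} ≤ k ≤ 2 r^{1/3}`. [folklore] -/
theorem scale_k_bounds {r : ℕ} (hr : 1 ≤ r) :
    (r : ℝ) ^ ((1 : ℝ) / 3) ≤ ((⌊(r : ℝ) ^ ((1 : ℝ) / 3)⌋₊ + 1 : ℕ) : ℝ) ∧
      ((⌊(r : ℝ) ^ ((1 : ℝ) / 3)⌋₊ + 1 : ℕ) : ℝ) ≤ 2 * (r : ℝ) ^ ((1 : ℝ) / 3) := by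
  have hr1 : (1 : ℝ) ≤ r := by exact_mod_cast hr
  have hx1 : (1 : ℝ) ≤ (r : ℝ) ^ ((1 : ℝ) / 3) := Real.one_le_rpow hr1 (by norm_num)
  constructor
  · push_cast
    exact (Nat.lt_floor_add_one _).le
  · push_cast
    have := Nat.floor_le (a := (r : ℝ) ^ ((1 : ℝ) / 3)) (by positivity)
    linarith

/-- Under `P_p` only lattice edges are open: the complement of `{ω | ω ⊆ E(ℤ³)}` is null. [folklore] -/
theorem measureReal_compl_subset_edgeSet (p : unitInterval) :
    (bondPercolation (zdGraph 3) p).real {ω : BondConfig (Site 3) | ω ⊆ (zdGraph 3).edgeSet}ᶜ = 0 := by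
  have hae : ∀ᵐ ω ∂(bondPercolation (zdGraph 3) p), ω ⊆ (zdGraph 3).edgeSet :=
    ProbabilityTheory.setBernoulli_ae_subset
  rw [ae_iff] at hae
  simp [Measure.real, Set.compl_setOf, hae]

end ThinFootReshape

open ThinFootReshape

/-- **K3 ⟸ K3'** (the reshape of the thin part of the crux). If thin-footed HIGH clusters are polynomially rare at
`p_c(ℤ³)` (`P_{p_c}(∃ v ∈ C_H(0), v₀ ≥ k, and F ≤ ⌊k^δ⌋) ≤ C k^{-a}`, `a, δ > 0`), then so are thin-footed TALL ones:
`P_{p_c}(arm_H(0,r), F ≤ ⌊r^{δ'}⌋) ≤ (C⁺ + 2) r^{-min(a/3,1/2)}` with `δ' = min(δ/3, 1/6)`. Proof: put `k = ⌊r^{1/3}⌋ + 1`,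
`m = ⌊r^{δ'}⌋ ≤ ⌊k^δ⌋`; on lattice configurations (a.s., `setBernoulli_ae_subset`) a thin-footed arm either has a vertex at
height `≥ k` — probability `≤ C k^{-a} ≤ C⁺ r^{-a/3}` — or its cluster lies in the slab `{x₀ < k}` and has `≥ r + 1` vertices
(`stub_armVolume`, p137693), an event of probability `≤ m k/(r+1) ≤ 2 r^{-1/2}` (`stub_thinFootSlabVolume`, p137452: the
ℤ²-level mass transport `E[N_h 1{F ≤ m}/F] ≤ 1` + Markov). [folklore] -/
theorem thinFootTall_of_thinFootHigh
    (hH : ∃ a δ C : ℝ, 0 < a ∧ 0 < δ ∧ ∀ k : ℕ, 1 ≤ k → (bondPercolation (zdGraph 3) (criticalProbI 3)).real ({ω | ∃ v ∈ clusterH ω 0, (k : ℤ) ≤ v 0} ∩ {ω | footAt ω 0 ≤ ((⌊(k : ℝ) ^ δ⌋₊ : ℕ) : ℕ∞)}) ≤ C * (k : ℝ) ^ (-a)) :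
    ∃ a δ C : ℝ, 0 < a ∧ 0 < δ ∧ ∀ r : ℕ, 1 ≤ r → (bondPercolation (zdGraph 3) (criticalProbI 3)).real (armH r ∩ {ω | footAt ω 0 ≤ ((⌊(r : ℝ) ^ δ⌋₊ : ℕ) : ℕ∞)}) ≤ C * (r : ℝ) ^ (-a) := by
  obtain ⟨a, δ, C, ha, hδ, hH⟩ := hH
  set δ' : ℝ := min (δ / 3) (1 / 6) with hδ'
  have hδ'pos : 0 < δ' := lt_min (by linarith) (by norm_num)
  refine ⟨min (a / 3) (1 / 2), δ', max C 0 + 2, lt_min (by linarith) (by norm_num), hδ'pos, fun r hr => ?_⟩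
  set μ := bondPercolation (zdGraph 3) (criticalProbI 3) with hμ
  have hr0 : (0 : ℝ) < r := by exact_mod_cast hr
  have hr1 : (1 : ℝ) ≤ r := by exact_mod_cast hr
  -- the two scales
  set k : ℕ := ⌊(r : ℝ) ^ ((1 : ℝ) / 3)⌋₊ + 1 with hk
  set m : ℕ := ⌊(r : ℝ) ^ δ'⌋₊ with hm
  obtain ⟨hk_ge, hk_le⟩ := scale_k_bounds hr
  have hk1 : 1 ≤ k := Nat.succ_le_succ (Nat.zero_le _)
  have hx0 : (0 : ℝ) < (r : ℝ) ^ ((1 : ℝ) / 3) := Real.rpow_pos_of_pos hr0 _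
  have hk0 : (0 : ℝ) < k := hx0.trans_le hk_ge
  -- `m ≤ ⌊k^δ⌋`
  have hmk : m ≤ ⌊(k : ℝ) ^ δ⌋₊ := by
    apply Nat.floor_mono
    calc (r : ℝ) ^ δ' ≤ (r : ℝ) ^ (δ / 3) := Real.rpow_le_rpow_of_exponent_le hr1 (min_le_left _ _)
      _ = ((r : ℝ) ^ ((1 : ℝ) / 3)) ^ δ := by rw [← Real.rpow_mul hr0.le]; ring_nf
      _ ≤ (k : ℝ) ^ δ := Real.rpow_le_rpow hx0.le hk_ge hδ.le
  -- the events
  set A : Set (BondConfig (Site 3)) := armH r ∩ {ω | footAt ω 0 ≤ ((⌊(r : ℝ) ^ δ'⌋₊ : ℕ) : ℕ∞)} with hAdef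
  set B₁ : Set (BondConfig (Site 3)) :=
    {ω | ∃ v ∈ clusterH ω 0, (k : ℤ) ≤ v 0} ∩ {ω | footAt ω 0 ≤ ((⌊(k : ℝ) ^ δ⌋₊ : ℕ) : ℕ∞)} with hB₁
  set B₂ : Set (BondConfig (Site 3)) :=
    {ω | (((r + 1 : ℕ) : ℕ∞)) ≤ (clusterH ω 0 ∩ {v : Site 3 | v 0 < (k : ℤ)}).encard} ∩
      {ω | footAt ω 0 ≤ (m : ℕ∞)} with hB₂
  set E : Set (BondConfig (Site 3)) := {ω | ω ⊆ (zdGraph 3).edgeSet} with hE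
  -- the split (on lattice configurations)
  have hsplit : A ⊆ B₁ ∪ B₂ ∪ Eᶜ := by
    intro ω hω
    by_cases hωE : ω ∈ E
    · obtain ⟨harm, hfoot⟩ := hω
      by_cases hhigh : ∃ v ∈ clusterH ω 0, (k : ℤ) ≤ v 0
      · refine Or.inl (Or.inl ⟨hhigh, ?_⟩)
        exact le_trans (show footAt ω 0 ≤ (m : ℕ∞) from hfoot) (by exact_mod_cast hmk)
      · refine Or.inl (Or.inr ⟨?_, hfoot⟩)
        push Not at hhigh
        have hsub : clusterH ω 0 ∩ {v : Site 3 | v 0 < (k : ℤ)} = clusterH ω 0 := by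
          ext v
          simp only [Set.mem_inter_iff, Set.mem_setOf_eq, and_iff_left_iff_imp]
          exact fun hv => hhigh v hv
        rw [Set.mem_setOf_eq, hsub]
        exact stub_armVolume ω hωE r harm
    · exact Or.inr hωE
  -- the two probability bounds
  have hB₁le : μ.real B₁ ≤ C * (k : ℝ) ^ (-a) := hH k hk1
  have hB₂le : μ.real B₂ ≤ (m : ℝ) * k / ((r + 1 : ℕ) : ℝ) :=
    stub_thinFootSlabVolume (criticalProbI 3) k m (r + 1) (Nat.succ_le_succ (Nat.zero_le _))
  have hEreal : μ.real Eᶜ = 0 := measureReal_compl_subset_edgeSet (criticalProbI 3)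
  have hAle : μ.real A ≤ μ.real B₁ + μ.real B₂ := by
    calc μ.real A ≤ μ.real (B₁ ∪ B₂ ∪ Eᶜ) := measureReal_mono hsplit
      _ ≤ μ.real (B₁ ∪ B₂) + μ.real Eᶜ := measureReal_union_le _ _
      _ ≤ μ.real B₁ + μ.real B₂ + μ.real Eᶜ := add_le_add (measureReal_union_le _ _) le_rfl
      _ = μ.real B₁ + μ.real B₂ := by rw [hEreal, add_zero]
  -- arithmetic: first term
  have hmin₁ : (r : ℝ) ^ (-(a / 3)) ≤ (r : ℝ) ^ (-(min (a / 3) (1 / 2))) :=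
    Real.rpow_le_rpow_of_exponent_le hr1 (neg_le_neg (min_le_left _ _))
  have hmin₂ : (r : ℝ) ^ (-(1 / 2 : ℝ)) ≤ (r : ℝ) ^ (-(min (a / 3) (1 / 2))) :=
    Real.rpow_le_rpow_of_exponent_le hr1 (neg_le_neg (min_le_right _ _))
  have hka : (k : ℝ) ^ (-a) ≤ (r : ℝ) ^ (-(a / 3)) := by
    calc (k : ℝ) ^ (-a) ≤ ((r : ℝ) ^ ((1 : ℝ) / 3)) ^ (-a) :=
          Real.rpow_le_rpow_of_nonpos hx0 hk_ge (by linarith)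
      _ = (r : ℝ) ^ (-(a / 3)) := by rw [← Real.rpow_mul hr0.le]; ring_nf
  have h1 : C * (k : ℝ) ^ (-a) ≤ max C 0 * (r : ℝ) ^ (-(min (a / 3) (1 / 2))) :=
    calc C * (k : ℝ) ^ (-a) ≤ max C 0 * (k : ℝ) ^ (-a) :=
          mul_le_mul_of_nonneg_right (le_max_left _ _) (Real.rpow_nonneg hk0.le _)
      _ ≤ max C 0 * (r : ℝ) ^ (-(min (a / 3) (1 / 2))) :=
          mul_le_mul_of_nonneg_left (hka.trans hmin₁) (le_max_right _ _)
  -- arithmetic: second term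
  have hm_le : (m : ℝ) ≤ (r : ℝ) ^ ((1 : ℝ) / 6) := by
    calc (m : ℝ) ≤ (r : ℝ) ^ δ' := Nat.floor_le (Real.rpow_nonneg hr0.le _)
      _ ≤ (r : ℝ) ^ ((1 : ℝ) / 6) := Real.rpow_le_rpow_of_exponent_le hr1 (min_le_right _ _)
  have h2 : (m : ℝ) * k / ((r + 1 : ℕ) : ℝ) ≤ 2 * (r : ℝ) ^ (-(min (a / 3) (1 / 2))) := by
    have hr1' : (r : ℝ) ≤ ((r + 1 : ℕ) : ℝ) := by push_cast; linarith
    calc (m : ℝ) * k / ((r + 1 : ℕ) : ℝ)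
        ≤ (r : ℝ) ^ ((1 : ℝ) / 6) * (2 * (r : ℝ) ^ ((1 : ℝ) / 3)) / (r : ℝ) := by
          gcongr
      _ = 2 * ((r : ℝ) ^ ((1 : ℝ) / 6) * (r : ℝ) ^ ((1 : ℝ) / 3) * (r : ℝ) ^ (-(1 : ℝ))) := by
          rw [Real.rpow_neg_one, div_eq_mul_inv]; ring
      _ = 2 * (r : ℝ) ^ (-(1 / 2 : ℝ)) := by
          rw [← Real.rpow_add hr0, ← Real.rpow_add hr0]; norm_num
      _ ≤ 2 * (r : ℝ) ^ (-(min (a / 3) (1 / 2))) := by linarith [hmin₂]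
  -- conclusion
  calc μ.real A ≤ μ.real B₁ + μ.real B₂ := hAle
    _ ≤ C * (k : ℝ) ^ (-a) + (m : ℝ) * k / ((r + 1 : ℕ) : ℝ) := add_le_add hB₁le hB₂le
    _ ≤ max C 0 * (r : ℝ) ^ (-(min (a / 3) (1 / 2))) + 2 * (r : ℝ) ^ (-(min (a / 3) (1 / 2))) :=
        add_le_add h1 h2
    _ = (max C 0 + 2) * (r : ℝ) ^ (-(min (a / 3) (1 / 2))) := by ring

/-- **K3 ⟹ K3'** (the reshape loses nothing): a cluster vertex `v` with `v₀ ≥ k` is at sup-distance `≥ k` from `0`, so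
`{∃ v ∈ C_H(0), v₀ ≥ k} ⊆ arm_H(0,k)` and the thin-foot thresholds `⌊k^δ⌋` agree. [folklore] -/
theorem thinFootHigh_of_thinFootTall
    (h : ∃ a δ C : ℝ, 0 < a ∧ 0 < δ ∧ ∀ r : ℕ, 1 ≤ r → (bondPercolation (zdGraph 3) (criticalProbI 3)).real (armH r ∩ {ω | footAt ω 0 ≤ ((⌊(r : ℝ) ^ δ⌋₊ : ℕ) : ℕ∞)}) ≤ C * (r : ℝ) ^ (-a)) :
    ∃ a δ C : ℝ, 0 < a ∧ 0 < δ ∧ ∀ k : ℕ, 1 ≤ k → (bondPercolation (zdGraph 3) (criticalProbI 3)).real ({ω | ∃ v ∈ clusterH ω 0, (k : ℤ) ≤ v 0} ∩ {ω | footAt ω 0 ≤ ((⌊(k : ℝ) ^ δ⌋₊ : ℕ) : ℕ∞)}) ≤ C * (k : ℝ) ^ (-a) := by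
  obtain ⟨a, δ, C, ha, hδ, h⟩ := h
  refine ⟨a, δ, C, ha, hδ, fun k hk => le_trans (measureReal_mono ?_) (h k hk)⟩
  rintro ω ⟨⟨v, hv, hvk⟩, hfoot⟩
  refine ⟨⟨v, ⟨0, ?_⟩, hv⟩, hfoot⟩
  exact hvk.trans (le_abs_self _)

/-- **`ThinFootTall ⟺ ThinFootHigh`**: the thin part of the crux may be stated with the cluster reaching HEIGHT `k` in
place of sup-distance `r` ("wlog the thin-footed arm goes straight up"). [folklore] -/
theorem thinFootTall_iff_thinFootHigh :
    (∃ a δ C : ℝ, 0 < a ∧ 0 < δ ∧ ∀ r : ℕ, 1 ≤ r → (bondPercolation (zdGraph 3) (criticalProbI 3)).real (armH r ∩ {ω | footAt ω 0 ≤ ((⌊(r : ℝ) ^ δ⌋₊ : ℕ) : ℕ∞)}) ≤ C * (r : ℝ) ^ (-a)) ↔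
      (∃ a δ C : ℝ, 0 < a ∧ 0 < δ ∧ ∀ k : ℕ, 1 ≤ k → (bondPercolation (zdGraph 3) (criticalProbI 3)).real ({ω | ∃ v ∈ clusterH ω 0, (k : ℤ) ≤ v 0} ∩ {ω | footAt ω 0 ≤ ((⌊(k : ℝ) ^ δ⌋₊ : ℕ) : ℕ∞)}) ≤ C * (k : ℝ) ^ (-a)) :=
  ⟨thinFootHigh_of_thinFootTall, thinFootTall_of_thinFootHigh⟩

/-- **The crux ⟹ K3'** (so K3' is a NECESSARY part of the crux, like K3 and `FootprintTail`). [folklore] -/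
theorem thinFootHigh_of_quantitativeBGN
    (h : Summit.CriticalPhenomena.PercolationContinuityZ3.Theses.PercLowPointHalfSpace.QuantitativeBGN) :
    ∃ a δ C : ℝ, 0 < a ∧ 0 < δ ∧ ∀ k : ℕ, 1 ≤ k → (bondPercolation (zdGraph 3) (criticalProbI 3)).real ({ω | ∃ v ∈ clusterH ω 0, (k : ℤ) ≤ v 0} ∩ {ω | footAt ω 0 ≤ ((⌊(k : ℝ) ^ δ⌋₊ : ℕ) : ℕ∞)}) ≤ C * (k : ℝ) ^ (-a) :=
  thinFootHigh_of_thinFootTall (thinFootTall_of_quantitativeBGN h)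

/-- **K2_T + K3' ⟹ the crux BY NAME** — the line `longrange-wall-ghost-bootstrap` in its lead-c5 form, kernel-checked
modulo its two open stubs `stub_wallStable` (K2_T: the weakly long-range-enhanced wall is subcritical at every `p < p_c`)
and `stub_thinFootHigh` (K3'); the five landed stubs (K1, bootstrap, transfer, slab volume, arm volume) are discharged
inside. [folklore] -/
theorem quantitativeBGN_of_wallStable_of_thinFootHigh : (∃ α lam : ℝ, 0 < α ∧ α < 1 ∧ 0 < lam ∧ ∀ p : unitInterval, (p : ℝ) < criticalProb (zdGraph 3) (0 : Site 3) → ∫⁻ ω, ((clusterH ω 0).encard : ℝ≥0∞) ∂(augWall p lam α) < ⊤) → (∃ a δ C : ℝ, 0 < a ∧ 0 < δ ∧ ∀ k : ℕ, 1 ≤ k → (bondPercolation (zdGraph 3) (criticalProbI 3)).real ({ω | ∃ v ∈ clusterH ω 0, (k : ℤ) ≤ v 0} ∩ {ω | footAt ω 0 ≤ ((⌊(k : ℝ) ^ δ⌋₊ : ℕ) : ℕ∞)}) ≤ C * (k : ℝ) ^ (-a)) → Summit.CriticalPhenomena.PercolationContinuityZ3.Theses.PercLowPointHalfSpace.QuantitativeBGN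 :=
  fun h₁ hH => quantitativeBGN_of_wallStable_of_thinFootTall h₁ (thinFootTall_of_thinFootHigh hH)

/-- **`QuantitativeBGN ⟺ FootprintTail ∧ ThinFootHigh`**: the crux is EQUIVALENT to the conjunction of its FAT part
(`∃ θ > 0, B, P_{p_c}(|C_H(0) ∩ ∂H| ≥ n) ≤ B n^{-θ}`) and its reshaped THIN part K3'
(`∃ a, δ > 0, C, P_{p_c}(∃ v ∈ C_H(0), v₀ ≥ k, |C_H(0) ∩ ∂H| ≤ ⌊k^δ⌋) ≤ C k^{-a}`). [folklore] -/
theorem quantitativeBGN_iff_footprintTail_and_thinFootHigh :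
    Summit.CriticalPhenomena.PercolationContinuityZ3.Theses.PercLowPointHalfSpace.QuantitativeBGN ↔
      (∃ θ B : ℝ, 0 < θ ∧ ∀ n : ℕ, 1 ≤ n → (bondPercolation (zdGraph 3) (criticalProbI 3)).real (footGe 0 n) ≤ B * (n : ℝ) ^ (-θ)) ∧
        (∃ a δ C : ℝ, 0 < a ∧ 0 < δ ∧ ∀ k : ℕ, 1 ≤ k → (bondPercolation (zdGraph 3) (criticalProbI 3)).real ({ω | ∃ v ∈ clusterH ω 0, (k : ℤ) ≤ v 0} ∩ {ω | footAt ω 0 ≤ ((⌊(k : ℝ) ^ δ⌋₊ : ℕ) : ℕ∞)}) ≤ C * (k : ℝ) ^ (-a)) :=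
  ⟨fun h => ⟨footprintTail_of_quantitativeBGN h, thinFootHigh_of_quantitativeBGN h⟩,
    fun h => quantitativeBGN_of_footprintTail_of_thinFootTall h.1 (thinFootTall_of_thinFootHigh h.2)⟩

end Summit.CriticalPhenomena.PercolationContinuityZ3.Theorems

end
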